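import Summits.QuantumFields.YangMills.Theorems.UnitScaleTiltFluctuationComparisonRegPrGlobalSlackLegCfgDistNaturalRowsDoor
import HarnessLib

/-!
# `UnitScaleTiltFluctuationComparisonRegPrGlobalSlackLegCfgDistNaturalRowsSel` — THE NATURAL CONFIGURATION FAMILY WITH A SELECTED ANCHOR `B♮[sel]`: ym-inputs-p11's rows ((N)-configuration
# clause, (R4-low), (M1) from print's (43), (R4) and the I-11 row (44) at the v4 χ-package) RE-RUN FOR AN ARBITRARY ANCHOR SELECTOR `sel K b Y ∈ anchors K b Y`
# (crux `FluctuationComparisonRegPrIntL`, stmt-QuantumFields-20520, skeleton v5kD, STUB 3⁗χ(v4) `stub_globalTwoRunSlackFamChiV4`; LEAD ym-ust-20520-w2 g5, currency decision 2026-08-28 after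
# ym-inputs-p12 g6's located anchor defect; count-neutral helper, def-free, registry untouched; ✓p626760 / ✓p629416 / ✓p631357 stay byte-untouched — this file is ADDITIVE)

WHY.  p11's natural family `B♮ᴿ` (✓p621414 / ✓p626760 / ✓p631357, written inline) anchors print's (27) loop variable of the point set `Y` at `y(Y) := (anchors_nonempty K b Y).choose`.
ym-inputs-p12 g6 LOCATED (2026-08-28) that in every TWO-RUN row ((BC) `CfgDistCauchyΦ`, (R5) `CfgRefOwnΦ`) the run-`K` and run-`(K+1)` anchors are then UNRELATED `Classical.choose`s
(the anchor SETS are matched, ✓`anchors_refineSet`; the choices are not), so (BC)[B♮ᴿ] / (R5)[B♮ᴿ] are not dischargeable as typed at any non-flat background (the difference carries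
a whole plaquette `‖log Ū^{(j)}(∂p)‖` against the asked `(L^{−(1+j)})^a`).  LEAD's currency decision: the natural configuration family is stated for an ARBITRARY anchor selector
`sel : (K b : ℕ) → Set (Site (F.P K) 0) → Site (F.P K) b` under the single letter `hsel : ∀ K b Y, sel K b Y ∈ anchors K b Y` — `B♮[sel]`; instances: `sel := fun K b Y ↦
(anchors_nonempty K b Y).choose` (today's `B♮ᴿ`) and p12 g6's RUN-COHERENT selector (`exists_anchorSel_coherent`: `sel (K+1) (b+1) (refineSet Y) = liftSite (sel K b Y)`), at
which the two-run rows are well-posed; the (α)-record desk (B0) stays free to pick its convention.  Every one-run row p11 proved for `B♮ᴿ` uses the anchor only through its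
MEMBERSHIP in `anchors K b Y` (`choose_spec`), so the proofs re-run verbatim with `hsel`:

* §2 (free letters `Bnew`, `U`): `naturalSel_newLevel_eq`, ★ `cfgDistOwnΦLow_naturalSel_of_minRows` ((R4-low), any datum whose old listed domains are blocks);
* §2′ (rows record `q`): `naturalRowsSel_newLevel_eq_bcfg` ((N)'s configuration clause), ★ `cfgDistOwnΦLow_naturalRowsSel` (exactness `coe_natural(Rows)_eq_vecE_B27T` ports the same way — omitted for size);
* §3: `newLevelIsBirthRows_naturalRowsSel`, ★ `newLevelIsBirthRows_naturalChartSel` (`hsep`), ★★ `oldTermsAreJetsOwnRows_naturalSel_of_kernelRow` ((M1) ⇐ print's (43) kernel row);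
* §4 (v4 χ-package): `cfgDistOwnΦ_chiV4_naturalSel` ((R4)), ★ `cfgDistΦ_chiV4_naturalSel` (THE I-11 ROW (44) for `B♮[sel]`, both runs), `cfgDistΦ_chiV4_naturalSel_of_le_gammaθ`.

HONEST SCOPE.  A port (anchor `choose ↦ sel`, `choose_spec ↦ hsel`) of landed bookkeeping; no new estimate; (M1)'s kernel row, (R4)'s window letters stay HYPOTHESES; nothing of
[Balaban1985UV3] / [King1986] asserted; no stub / crux / registry object touched (`--supports stmt-QuantumFields-20520`); no summit / rung / gap claim (YM₃ on T³ is ladder rung R3,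
not the Clay problem).  L-floor: none beyond `1 < L`.

References: T. Bałaban, CMP 102 (1985) 255–275 [Balaban1985UV3] ((27)–(28) p.263, p.263 L4, (30) p.263, (33)–(34) p.264, (43)–(44) pp.266–267, (59)–(61) pp.270–271); CMP 102 (1985)
277–309 [Balaban1985Variational] (Thm 1 (8) p.279); CMP 98 (1985) 17–51 [Balaban1985Averaging] (Prop. 2 (54) p.26); CMP 109 (1987) 249–301 [Balaban1987RG1] ((0.1) p.251).
-/

set_option autoImplicit false

noncomputable section

open scoped Matrix.Norms.L2Operator Nat BigOperators
open Literature.MathematicalPhysics.QuantumFieldTheory.Balaban1983to89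
open Literature.MathematicalPhysics.QuantumFieldTheory.Balaban1983to89.T3ContinuumYM3Torus
open Literature.MathematicalPhysics.QuantumFieldTheory.Balaban1983to89.T3UnitLawDensityEML (ℰp)
open Literature.MathematicalPhysics.QuantumFieldTheory.Balaban1983to89.T3UnitScaleTilt (θBal)
open Literature.MathematicalPhysics.QuantumFieldTheory.Balaban1983to89.T3LevelShift (fieldShift)
open Literature.MathematicalPhysics.QuantumFieldTheory.Balaban1983to89.T3AlphaInputsAC (AlphaDataT3)
open Literature.MathematicalPhysics.QuantumFieldTheory.Balaban1983to89.TreeLengthTorus (tsys)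
open Literature.MathematicalPhysics.QuantumFieldTheory.Balaban1983to89.B10Eq27TorusAxialLog
open Literature.MathematicalPhysics.QuantumFieldTheory.Balaban1983to89.B7Prop1Explicit (l1)
open Literature.MathematicalPhysics.QuantumFieldTheory.Balaban1983to89.ExpMeanLog (deltaSU deltaSU_pos)
open Literature.MathematicalPhysics.QuantumFieldTheory.Balaban1985CMP102
open Literature.MathematicalPhysics.QuantumFieldTheory.Balaban1985CMP102.Setting
open Summit.QuantumFields.Balaban3D.Carriers
open Summit.QuantumFields.Balaban3D.Proofs.Primitives
open Summit.QuantumFields.Balaban3D.Proofs.GroupModelLieC (vecE lieC)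
open Summit.QuantumFields.YangMills.Theorems
open Summit.QuantumFields.YangMills.Theorems.GlobalSlackKernelMatching
open Summit.QuantumFields.YangMills.Theorems.GlobalSlackCanonicalPolymers

namespace Summit.QuantumFields.YangMills.Theorems.GlobalSlackKernelLeg

variable {F : T3Family} {𝔠 : AlphaConsts F.L (suGroupModel 2).N} {γ : ℝ} {hγ : 0 < γ} {hγ1 : γ ≤ (min 𝔠.gamma0 1) ^ 2}
  (sel : (K b : ℕ) → Set (Site (F.P K) 0) → Site (F.P K) b) (hsel : ∀ (K b : ℕ) (Y : Set (Site (F.P K) 0)), sel K b Y ∈ anchors K b Y)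

/-! ## §2 The natural family at free letters: a free new-level branch `Bnew`, a free minimiser family `U` with the rows r1–r3 -/

section Free

variable (Bnew : (K b : ℕ) → Set (Site (F.P K) 0) → GaugeField (F.P K) (b + 1) (Matrix.specialUnitaryGroup (Fin 2) ℂ) →
    PBond (F.P K) b → ↥(lieC (suGroupModel 2)))
  (U : (K k : ℕ) → Hist (F.P K) k → GaugeField (F.P K) k (Matrix.specialUnitaryGroup (Fin 2) ℂ) →
    GaugeField (F.P K) 0 (Matrix.specialUnitaryGroup (Fin 2) ℂ))

open Classical in
/-- **ON THE NEW LEVEL `B♮[Bnew, U]` IS ITS NEW-LEVEL BRANCH**: `B♮ K (k+1) k Y W = Bnew K k Y W` (definitional). [cite: Balaban1985UV3, (27) p.263, (60)-(61) p.271] -/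
theorem naturalSel_newLevel_eq {p₁ : ℝ} (K k : ℕ) (Y : Set (Site (F.P K) 0)) (W : GaugeField (F.P K) (k + 1) (Matrix.specialUnitaryGroup (Fin 2) ℂ)) :
    (fun K k b Y W c =>
        if h : b + 1 = k then Bnew K b Y (h ▸ W) c
        else if (l1 (rel (sel K b Y) c.src) : ℝ) *
            (2 * (𝔠.B₃ * θBal F.L γ 𝔠.b₀ p₁ (K - k)) * (((F.L : ℝ) ^ (k - b))⁻¹) ^ 2) ≤ 1 / 2 then
          (lieC (suGroupModel 2)).orthogonalProjectionOnto
            (vecE (suGroupModel 2).N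
              (B27T (unitsField (toUField (Averaging.iter (fun i => BlockAveraging.blockAvg (P := F.P K) (j := i) ℰp) b
                (U K k (Hist.triv (F.P K) k) W)))) (sel K b Y) c))
        else 0) K (k + 1) k Y W = Bnew K k Y W := by
  funext c
  dsimp only
  rw [dif_pos rfl]

include hsel in
open Classical in
/-- ★ **(R4-low) FOR THE NATURAL FAMILY AT FREE LETTERS**: for ANY datum `D : AlphaDataT3 F γ` whose listed domains below the new level (term level `1 ≤ i < k`, lattice level `k ≤ K`,
trivial history) are single blocks (`hD`), ANY new-level branch `Bnew` and ANY minimiser family `U` carrying the rows `MinimiserRowsT3 … (a₀ K) (a₁ K) K (U K)`, the natural family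
`B♮[Bnew, U]` satisfies `CfgDistOwnΦLow D B♮ (canonLegDist F) 𝔠.b₀ p₁ (24·L·B₃)` at every profile `p₁`, as soon as every window `θ_{b₀,p₁}(n)`, `n < K`, lies in r1's range
`θ ≤ a₁ K`, `B₃θ ≤ a₀ K` and inside [B7] Prop. 2's two smallness letters (`hθ`).  Proof = ✓`cfgDistOwnΦLow_chi_natural`'s, reading the record only through `hD` and `hmin`.
[cite: Balaban1985UV3, (43)-(44) pp.266-267, (27)-(28) p.263; Balaban1985Variational, Thm 1 (8) p.279; Balaban1985Averaging, Prop. 2 (54) p.26] -/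
theorem cfgDistOwnΦLow_naturalSel_of_minRows (D : AlphaDataT3 F γ)
    (hD : ∀ (K k i : ℕ), k ≤ K → i < k → 1 ≤ i → ∀ Y ∈ D.Loc K k (D.triv K k) i, ∃ y : Site (F.P K) i, Y = blockSet K i y)
    {a₀ a₁ : ℕ → ℝ} (hmin : ∀ K, MinimiserRowsT3 F 𝔠 γ hγ hγ1 (a₀ K) (a₁ K) K (U K)) {p₁ : ℝ}
    (hθ : ∀ K n, n < K →
      θBal F.L γ 𝔠.b₀ p₁ n ≤ a₁ K ∧ 𝔠.B₃ * θBal F.L γ 𝔠.b₀ p₁ n ≤ a₀ K ∧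
      (143 * ((((3 + 4 : ℕ) : ℝ)) ^ 2 / 4) ^ 2) * (𝔠.B₃ * θBal F.L γ 𝔠.b₀ p₁ n) ≤ 1 / 3 ∧
      2 * (𝔠.B₃ * θBal F.L γ 𝔠.b₀ p₁ n) ≤ 2 * deltaSU (Fin 2) / (((3 + 4) * F.L : ℕ) : ℝ) ^ 2) :
    CfgDistOwnΦLow D
      (fun K k b Y W c =>
        if h : b + 1 = k then Bnew K b Y (h ▸ W) c
        else if (l1 (rel (sel K b Y) c.src) : ℝ) *
            (2 * (𝔠.B₃ * θBal F.L γ 𝔠.b₀ p₁ (K - k)) * (((F.L : ℝ) ^ (k - b))⁻¹) ^ 2) ≤ 1 / 2 then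
          (lieC (suGroupModel 2)).orthogonalProjectionOnto
            (vecE (suGroupModel 2).N
              (B27T (unitsField (toUField (Averaging.iter (fun i => BlockAveraging.blockAvg (P := F.P K) (j := i) ℰp) b
                (U K k (Hist.triv (F.P K) k) W)))) (sel K b Y) c))
        else 0)
      (canonLegDist F) 𝔠.b₀ p₁ (24 * F.L * 𝔠.B₃) := by
  intro K n hnK j hj V hV Y hY c
  have hn : n < K := by omega
  have hKn : K - (K - n) = n := by omega
  have hjne : ¬ (j + 1 = K - n) := by omega
  obtain ⟨y', rfl⟩ := hD K (K - n) (1 + j) (by omega) (by omega) (by omega) Y hY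
  set y := sel K j (blockSet K (1 + j) y') with hydef
  have hy : y ∈ anchors K j (blockSet K (1 + j) y') := hsel K j (blockSet K (1 + j) y')
  obtain ⟨h1, h2, h3, h4⟩ := hθ K n hn
  have hγ1' : γ ≤ 1 := hγ1.trans (sq_min_one_le _ 𝔠.gamma0_pos)
  have hθpos : 0 < θBal F.L γ 𝔠.b₀ p₁ n := T3MinimiserStabilityReduction.θBal_pos F.hL.2.le hγ hγ1' 𝔠.b₀_pos p₁ n
  have hrhs : 0 ≤ 24 * (F.L : ℝ) * 𝔠.B₃ * (1 + canonLegDist F K j (blockSet K (1 + j) y') c) * θBal F.L γ 𝔠.b₀ p₁ n *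
      (((F.L : ℝ) ^ (K - n - 1 - j))⁻¹) ^ 2 := by
    have := 𝔠.B₃_pos
    have := canonLegDist_nonneg F K j (blockSet K (1 + j) y') c
    positivity
  dsimp only
  rw [dif_neg hjne, hKn]
  split_ifs with hreg
  · calc _ ≤ 2 * ‖B27T (unitsField (toUField (Averaging.iter (fun i => BlockAveraging.blockAvg (P := F.P K) (j := i) ℰp) j
            (U K (K - n) (Hist.triv (F.P K) (K - n))
              (fieldShift (F.sitesPerDir_eq (m := F.m) (K := K) (j := K - n) (m' := F.m) (K' := n) (j' := 0) (by omega)) V))))) y c‖ :=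
          norm_proj_vecE_two_le _
      _ ≤ 2 * ((12 * (F.L : ℝ) * 𝔠.B₃) * (1 + canonLegDist F K j (blockSet K (1 + j) y') c) * θBal F.L γ 𝔠.b₀ p₁ n *
            (((F.L : ℝ) ^ (K - n - 1 - j))⁻¹) ^ 2) :=
          mul_le_mul_of_nonneg_left (norm_B27T_avg_minimiser_le_canonLegDist_window (hmin K) hn hθpos
            h1 h2 h3 h4 V hV (show 1 + j = j + 1 by omega) (by omega) y' hy c hreg) (by norm_num)
      _ = _ := by ring
  · rw [norm_zero]
    exact hrhs

end Free

/-! ## §3 The natural family of a rows record: `B♮ᴿ := B♮[birthCfgAtRows q, fun K ↦ (q K).UkH]` -/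

section Rows

variable (q : ∀ K, AlphaInputsT3AC.PkgCoreRows F 𝔠 γ hγ hγ1 K)

open Classical in
/-- **(N)'s CONFIGURATION CLAUSE FOR `B♮ᴿ`**: on the new level the natural family of a rows record IS the birth configuration — `B♮ᴿ K (k+1) k (domSet X) W = Bcfg_X(triv, W)` for every
retained step-`k` domain `X` of `newDomsRows q` (`k + 1 ≤ K`; ✓`birthCfgAtRows_domSet`). [cite: Balaban1985UV3, (27) p.263, (60)-(61) p.271] -/
theorem naturalRowsSel_newLevel_eq_bcfg {p₁ : ℝ} (K k : ℕ) (hk : k + 1 ≤ K)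
    (X : (tsys 3 (nblkOf (SK F 𝔠 γ hγ hγ1 K) 𝔠.lane.carrier k)).Dom) (hX : X ∈ newDomsRows q K k (Hist.triv (F.P K) (k + 1)))
    (W : GaugeField (F.P K) (k + 1) (Matrix.specialUnitaryGroup (Fin 2) ℂ)) :
    (fun K k b Y W c =>
        if h : b + 1 = k then birthCfgAtRows q K b Y (h ▸ W) c
        else if (l1 (rel (sel K b Y) c.src) : ℝ) *
            (2 * (𝔠.B₃ * θBal F.L γ 𝔠.b₀ p₁ (K - k)) * (((F.L : ℝ) ^ (k - b))⁻¹) ^ 2) ≤ 1 / 2 then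
          (lieC (suGroupModel 2)).orthogonalProjectionOnto
            (vecE (suGroupModel 2).N
              (B27T (unitsField (toUField (Averaging.iter (fun i => BlockAveraging.blockAvg (P := F.P K) (j := i) ℰp) b
                ((q K).UkH k (Hist.triv (F.P K) k) W)))) (sel K b Y) c))
        else 0) K (k + 1) k (domSet (F := F) 𝔠.lane.carrier.M₁ K k X) W =
      ((q K).𝔖 k).Bcfg X (Hist.triv (F.P K) (k + 1)) W := by
  rw [naturalSel_newLevel_eq sel (birthCfgAtRows q) (fun K => (q K).UkH)]
  exact birthCfgAtRows_domSet q K k (by have := F.hm; omega) X hX W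

include hsel in
open Classical in
/-- ★ **(R4-low) `CfgDistOwnΦLow` FOR `B♮ᴿ` AT THE ROWS DATUM** `dataOfCoreRows q (canonPolymerRows q)`, every profile `p₁`, constant `24·L·B₃`, under the window letters `hθ` at the record's
own `(q K).a₀`, `(q K).a₁` (`cfgDistOwnΦLow_naturalSel_of_minRows` at `hD := exists_blockSet_of_mem_canonLocRows q`, `hmin K := (q K).minRows`).  The v4 χ-package instance is
`q := fun K ↦ (p K).toRows` (datum `dataOfV4chi p (canonPolymerRows fun K ↦ (p K).toRows)`, by `rfl`); the v3 χ-package instance is ✓`cfgDistOwnΦLow_chi_natural`.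
[cite: Balaban1985UV3, (43)-(44) pp.266-267, (27)-(28) p.263; Balaban1985Variational, Thm 1 (8) p.279; Balaban1985Averaging, Prop. 2 (54) p.26] -/
theorem cfgDistOwnΦLow_naturalRowsSel {p₁ : ℝ}
    (hθ : ∀ K n, n < K →
      θBal F.L γ 𝔠.b₀ p₁ n ≤ (q K).a₁ ∧ 𝔠.B₃ * θBal F.L γ 𝔠.b₀ p₁ n ≤ (q K).a₀ ∧
      (143 * ((((3 + 4 : ℕ) : ℝ)) ^ 2 / 4) ^ 2) * (𝔠.B₃ * θBal F.L γ 𝔠.b₀ p₁ n) ≤ 1 / 3 ∧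
      2 * (𝔠.B₃ * θBal F.L γ 𝔠.b₀ p₁ n) ≤ 2 * deltaSU (Fin 2) / (((3 + 4) * F.L : ℕ) : ℝ) ^ 2) :
    CfgDistOwnΦLow (AlphaInputsT3AC.dataOfCoreRows q (canonPolymerRows q))
      (fun K k b Y W c =>
        if h : b + 1 = k then birthCfgAtRows q K b Y (h ▸ W) c
        else if (l1 (rel (sel K b Y) c.src) : ℝ) *
            (2 * (𝔠.B₃ * θBal F.L γ 𝔠.b₀ p₁ (K - k)) * (((F.L : ℝ) ^ (k - b))⁻¹) ^ 2) ≤ 1 / 2 then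
          (lieC (suGroupModel 2)).orthogonalProjectionOnto
            (vecE (suGroupModel 2).N
              (B27T (unitsField (toUField (Averaging.iter (fun i => BlockAveraging.blockAvg (P := F.P K) (j := i) ℰp) b
                ((q K).UkH k (Hist.triv (F.P K) k) W)))) (sel K b Y) c))
        else 0)
      (canonLegDist F) 𝔠.b₀ p₁ (24 * F.L * 𝔠.B₃) :=
  cfgDistOwnΦLow_naturalSel_of_minRows sel hsel (birthCfgAtRows q) (fun K => (q K).UkH) (AlphaInputsT3AC.dataOfCoreRows q (canonPolymerRows q))
    (fun _ _ _ hk hik hi1 _ hY => exists_blockSet_of_mem_canonLocRows q hk hik hi1 hY) (fun K => (q K).minRows) hθ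

end Rows

/-! ## §3 (N) and (M1) for the natural triples with a selected anchor -/

section Record

open Summit.QuantumFields.Balaban3D.Proofs.Representation33 (jet26)

variable (q : ∀ K, AlphaInputsT3AC.PkgCoreRows F 𝔠 γ hγ hγ1 K)

open Classical in
/-- **(N) `NewLevelIsBirthRows` FOR THE CANONICAL TRIPLE `(birthChartRows q, 0, B♮ᴿ)`** of every rows record `q` (the chart and vacuum-constant clauses by `rfl`, the configuration clause by
✓`naturalRowsSel_newLevel_eq_bcfg`). [cite: Balaban1985UV3, (33) p.264, (60)-(61) p.271] -/
theorem newLevelIsBirthRows_naturalRowsSel {p₁ : ℝ} :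
    NewLevelIsBirthRows q (birthChartRows q) (fun _ _ _ => 0)
      (fun K k b Y W c =>
        if h : b + 1 = k then birthCfgAtRows q K b Y (h ▸ W) c
        else if (l1 (rel (sel K b Y) c.src) : ℝ) *
            (2 * (𝔠.B₃ * θBal F.L γ 𝔠.b₀ p₁ (K - k)) * (((F.L : ℝ) ^ (k - b))⁻¹) ^ 2) ≤ 1 / 2 then
          (lieC (suGroupModel 2)).orthogonalProjectionOnto
            (vecE (suGroupModel 2).N
              (B27T (unitsField (toUField (Averaging.iter (fun i => BlockAveraging.blockAvg (P := F.P K) (j := i) ℰp) b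
                ((q K).UkH k (Hist.triv (F.P K) k) W)))) (sel K b Y) c))
        else 0) := by
  intro K k hk X hX
  exact ⟨rfl, rfl, fun W => naturalRowsSel_newLevel_eq_bcfg sel q K k hk X hX W⟩

variable (N : (K b : ℕ) → Site (F.P K) (1 + b) → (n : ℕ) → (Fin n → PBond (F.P K) b) → ContinuousMultilinearMap ℂ (fun _ : Fin n => ↥(lieC (suGroupModel 2))) ℂ)

open Classical in
/-- ★ **(N) `NewLevelIsBirthRows` FOR THE NATURAL TRIPLE `(Φ♮[birthChartRows q, N], 0, B♮ᴿ)`** under the geometric letter `hsep` «no retained step-`k` domain of run `K` (trivial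
history, `k + 1 ≤ K`) has the point set of a level-`(k+1)` block» (the chart clause by `naturalChart_of_forall_ne`, the configuration clause by ✓`naturalRowsSel_newLevel_eq_bcfg`).
[cite: Balaban1985UV3, (33) p.264, (59)-(61) pp.270-271] -/
theorem newLevelIsBirthRows_naturalChartSel {p₁ : ℝ}
    (hsep : ∀ (K k : ℕ), k + 1 ≤ K → ∀ X ∈ newDomsRows q K k (Hist.triv (F.P K) (k + 1)), ∀ y : Site (F.P K) (1 + k),
      blockSet K (1 + k) y ≠ domSet (F := F) 𝔠.lane.carrier.M₁ K k X) :
    NewLevelIsBirthRows q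
      (fun K b Y =>
        if h : ∃ y : Site (F.P K) (1 + b), blockSet K (1 + b) y = Y then
          (fun x : PBond (F.P K) b → ↥(lieC (suGroupModel 2)) =>
            ∑ n ∈ Finset.Ico 2 7, ((n ! : ℂ))⁻¹ * ∑ c : Fin n → PBond (F.P K) b, N K b h.choose n c (fun i => x (c i)))
        else birthChartRows q K b Y)
      (fun _ _ _ => 0)
      (fun K k b Y W c =>
        if h : b + 1 = k then birthCfgAtRows q K b Y (h ▸ W) c
        else if (l1 (rel (sel K b Y) c.src) : ℝ) *
            (2 * (𝔠.B₃ * θBal F.L γ 𝔠.b₀ p₁ (K - k)) * (((F.L : ℝ) ^ (k - b))⁻¹) ^ 2) ≤ 1 / 2 then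
          (lieC (suGroupModel 2)).orthogonalProjectionOnto
            (vecE (suGroupModel 2).N
              (B27T (unitsField (toUField (Averaging.iter (fun i => BlockAveraging.blockAvg (P := F.P K) (j := i) ℰp) b
                ((q K).UkH k (Hist.triv (F.P K) k) W)))) (sel K b Y) c))
        else 0) := by
  intro K k hk X hX
  exact ⟨naturalChart_of_forall_ne (birthChartRows q) N (hsep K k hk X hX), rfl, fun W => naturalRowsSel_newLevel_eq_bcfg sel q K k hk X hX W⟩

open Classical in
/-- ★★ **(M1) `OldTermsAreJetsOwnRows` FOR THE NATURAL TRIPLE FROM PRINT'S (43) AS A ROW ON THE RECORD**: if the record's previous-scale terms at the trivial history ARE the leg-indexed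
kernel polynomials read at the natural loop variables — «for `k + 1 ≤ K`, `j < k`, every old block `y` of level `1 + j`, every `W`,
`oldTermRows q K k (1+j) y W = Re Σ_{n∈[2,7)} (n!)⁻¹ Σ_{c : Fin n → bonds} N K j y n c (B♮ᴿ K (k+1) j (blockSet y) W (c₁), …)`», print's «𝒫_j(Y_j, U_k) = ⟨𝒫_j(Y_j), B_k(c₁), …, B_k(c_n)⟩»
with field-independent kernels `N` — then (M1) holds for `(Φ♮[birthChartRows q, N], 0, B♮ᴿ)` (the row, then `jet26_naturalChart_blockSet`).  The row is a HYPOTHESIS, the definer's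
specification of `StepSeries.oldVal`; nothing is asserted. [cite: Balaban1985UV3, (43) p.266, (33)-(34) p.264, (30) p.263] -/
theorem oldTermsAreJetsOwnRows_naturalSel_of_kernelRow {p₁ : ℝ}
    (hK : ∀ (K k : ℕ), k + 1 ≤ K → ∀ j : ℕ, j < k →
      ∀ y ∈ oldBlocks 𝔠.lane.carrier.M₁ (rcolOf (SK F 𝔠 γ hγ hγ1 K) 𝔠.lane.carrier) (Hist.triv (F.P K) (k + 1)) (1 + j),
        ∀ W : GaugeField (F.P K) (k + 1) (Matrix.specialUnitaryGroup (Fin 2) ℂ),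
          oldTermRows q K k (1 + j) y W =
            (∑ n ∈ Finset.Ico 2 7, ((n ! : ℂ))⁻¹ * ∑ c : Fin n → PBond (F.P K) j, N K j y n c (fun i =>
              (fun K k b Y W c =>
                if h : b + 1 = k then birthCfgAtRows q K b Y (h ▸ W) c
                else if (l1 (rel (sel K b Y) c.src) : ℝ) *
                    (2 * (𝔠.B₃ * θBal F.L γ 𝔠.b₀ p₁ (K - k)) * (((F.L : ℝ) ^ (k - b))⁻¹) ^ 2) ≤ 1 / 2 then
                  (lieC (suGroupModel 2)).orthogonalProjectionOnto
                    (vecE (suGroupModel 2).N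
                      (B27T (unitsField (toUField (Averaging.iter (fun i => BlockAveraging.blockAvg (P := F.P K) (j := i) ℰp) b
                        ((q K).UkH k (Hist.triv (F.P K) k) W)))) (sel K b Y) c))
                else 0) K (k + 1) j (blockSet K (1 + j) y) W (c i))).re) :
    OldTermsAreJetsOwnRows q
      (fun K b Y =>
        if h : ∃ y : Site (F.P K) (1 + b), blockSet K (1 + b) y = Y then
          (fun x : PBond (F.P K) b → ↥(lieC (suGroupModel 2)) =>
            ∑ n ∈ Finset.Ico 2 7, ((n ! : ℂ))⁻¹ * ∑ c : Fin n → PBond (F.P K) b, N K b h.choose n c (fun i => x (c i)))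
        else birthChartRows q K b Y)
      (fun _ _ _ => 0)
      (fun K k b Y W c =>
        if h : b + 1 = k then birthCfgAtRows q K b Y (h ▸ W) c
        else if (l1 (rel (sel K b Y) c.src) : ℝ) *
            (2 * (𝔠.B₃ * θBal F.L γ 𝔠.b₀ p₁ (K - k)) * (((F.L : ℝ) ^ (k - b))⁻¹) ^ 2) ≤ 1 / 2 then
          (lieC (suGroupModel 2)).orthogonalProjectionOnto
            (vecE (suGroupModel 2).N
              (B27T (unitsField (toUField (Averaging.iter (fun i => BlockAveraging.blockAvg (P := F.P K) (j := i) ℰp) b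
                ((q K).UkH k (Hist.triv (F.P K) k) W)))) (sel K b Y) c))
        else 0) := by
  intro K k hk j hj y hy W
  rw [hK K k hk j hj y hy W, zero_add, jet26_naturalChart_blockSet (birthChartRows q) N (by have := F.hm; omega) y]

end Record

/-! ## §4 (R4), the I-11 row `CfgDistΦ` and its threshold form at the v4 χ-package, selected anchor -/

section ChiV4

include hsel in
open Classical in
/-- **(R4) `CfgDistOwnΦ` FOR `B♮ᴿ` AT THE v4 χ-PACKAGE AND EVERY PROFILE `p₁ ≥ p₀ + r₀`** (w2's `cfgDistOwnΦ_chiV4_of_low_of_newLevelIsBirth` on (R4-low) ✓`cfgDistOwnΦLow_naturalRowsSel` and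
(N) `newLevelIsBirthRows_naturalRowsSel` at `q := fun K ↦ (p K).toRows`): constant `max (24·L·B₃) (cB·(√L)⁻¹(1 + log √L)^{p₁})`, window letters `hθ` at the package's own `a₀`, `a₁`.
[cite: Balaban1985UV3, (27)-(28) p.263, (44) p.267; Balaban1985Variational, Thm 1 (8) p.279; Balaban1985Averaging, Prop. 2 (54) p.26] -/
theorem cfgDistOwnΦ_chiV4_naturalSel (p : ∀ K, AlphaInputsT3AC.PkgAtV4Chi F 𝔠 γ hγ hγ1 K) {p₁ : ℝ} (hp : 𝔠.p₀ + 𝔠.r₀ ≤ p₁)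
    (hθ : ∀ K n, n < K →
      θBal F.L γ 𝔠.b₀ p₁ n ≤ (p K).a₁ ∧ 𝔠.B₃ * θBal F.L γ 𝔠.b₀ p₁ n ≤ (p K).a₀ ∧
      (143 * ((((3 + 4 : ℕ) : ℝ)) ^ 2 / 4) ^ 2) * (𝔠.B₃ * θBal F.L γ 𝔠.b₀ p₁ n) ≤ 1 / 3 ∧
      2 * (𝔠.B₃ * θBal F.L γ 𝔠.b₀ p₁ n) ≤ 2 * deltaSU (Fin 2) / (((3 + 4) * F.L : ℕ) : ℝ) ^ 2) :
    CfgDistOwnΦ (AlphaInputsT3AC.dataOfV4chi p (canonPolymerRows fun K => (p K).toRows))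
      (fun K k b Y W c =>
        if h : b + 1 = k then birthCfgAtRows (fun K => (p K).toRows) K b Y (h ▸ W) c
        else if (l1 (rel (sel K b Y) c.src) : ℝ) *
            (2 * (𝔠.B₃ * θBal F.L γ 𝔠.b₀ p₁ (K - k)) * (((F.L : ℝ) ^ (k - b))⁻¹) ^ 2) ≤ 1 / 2 then
          (lieC (suGroupModel 2)).orthogonalProjectionOnto
            (vecE (suGroupModel 2).N
              (B27T (unitsField (toUField (Averaging.iter (fun i => BlockAveraging.blockAvg (P := F.P K) (j := i) ℰp) b
                ((p K).UkH k (Hist.triv (F.P K) k) W)))) (sel K b Y) c))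
        else 0)
      (canonLegDist F) 𝔠.b₀ p₁ (max (24 * F.L * 𝔠.B₃) (𝔠.cB * ((Real.sqrt F.L)⁻¹ * (1 + Real.log (Real.sqrt F.L)) ^ p₁))) :=
  cfgDistOwnΦ_chiV4_of_low_of_newLevelIsBirth p hp (by have := 𝔠.B₃_pos; have := F.hL.2; positivity)
    (newLevelIsBirthRows_naturalRowsSel sel fun K => (p K).toRows) (cfgDistOwnΦLow_naturalRowsSel sel hsel (fun K => (p K).toRows) hθ)

include hsel in
open Classical in
/-- ★ **THE I-11 ROW (44) `CfgDistΦ` HOLDS FOR THE NATURAL FAMILY `B♮ᴿ` AT THE v4 χ-PACKAGE** (both runs, canonical leg distance, every profile `p₁ ≥ p₀ + r₀`, under the window letters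
`hθ`): `cfgDistΦ_of_own` on (R4) (`locMatched_canonRows`, `canonLegDist_matched`). [cite: Balaban1985UV3, (44) p.267; Balaban1987RG1, (0.1) p.251] -/
theorem cfgDistΦ_chiV4_naturalSel (p : ∀ K, AlphaInputsT3AC.PkgAtV4Chi F 𝔠 γ hγ hγ1 K) {p₁ : ℝ} (hp : 𝔠.p₀ + 𝔠.r₀ ≤ p₁)
    (hθ : ∀ K n, n < K →
      θBal F.L γ 𝔠.b₀ p₁ n ≤ (p K).a₁ ∧ 𝔠.B₃ * θBal F.L γ 𝔠.b₀ p₁ n ≤ (p K).a₀ ∧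
      (143 * ((((3 + 4 : ℕ) : ℝ)) ^ 2 / 4) ^ 2) * (𝔠.B₃ * θBal F.L γ 𝔠.b₀ p₁ n) ≤ 1 / 3 ∧
      2 * (𝔠.B₃ * θBal F.L γ 𝔠.b₀ p₁ n) ≤ 2 * deltaSU (Fin 2) / (((3 + 4) * F.L : ℕ) : ℝ) ^ 2) :
    CfgDistΦ (AlphaInputsT3AC.dataOfV4chi p (canonPolymerRows fun K => (p K).toRows))
      (fun K k b Y W c =>
        if h : b + 1 = k then birthCfgAtRows (fun K => (p K).toRows) K b Y (h ▸ W) c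
        else if (l1 (rel (sel K b Y) c.src) : ℝ) *
            (2 * (𝔠.B₃ * θBal F.L γ 𝔠.b₀ p₁ (K - k)) * (((F.L : ℝ) ^ (k - b))⁻¹) ^ 2) ≤ 1 / 2 then
          (lieC (suGroupModel 2)).orthogonalProjectionOnto
            (vecE (suGroupModel 2).N
              (B27T (unitsField (toUField (Averaging.iter (fun i => BlockAveraging.blockAvg (P := F.P K) (j := i) ℰp) b
                ((p K).UkH k (Hist.triv (F.P K) k) W)))) (sel K b Y) c))
        else 0)
      (canonLegDist F) 𝔠.b₀ p₁ (max (24 * F.L * 𝔠.B₃) (𝔠.cB * ((Real.sqrt F.L)⁻¹ * (1 + Real.log (Real.sqrt F.L)) ^ p₁))) :=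
  cfgDistΦ_of_own (locMatched_canonRows fun K => (p K).toRows) (canonLegDist_matched F) (cfgDistOwnΦ_chiV4_naturalSel sel hsel p hp hθ)

include hsel in
open Classical in
/-- **THE I-11 ROW `CfgDistΦ` FOR `B♮ᴿ` AT THE v4 χ-PACKAGE BELOW AN EXPLICIT COUPLING THRESHOLD**: at a coherent package (`(p K).a₀ = a₀`, `(p K).a₁ = a₁`), for every profile
`p₁ ≥ p₀ + r₀` and every coupling `γ ≤ gammaθ b₀ p₁ σ♮`, `σ♮ = min a₁ (min (a₀/B₃) (min (1/(3·143·(7²/4)²·B₃)) (δ_{SU(2)}/((7L)²·B₃))))` (✓`windowLetters_of_le_gammaθ`).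
[cite: Balaban1985UV3, (44) p.267, (27)-(28) p.263, (7) p.257; Balaban1985Variational, Thm 1 (8) p.279; Balaban1985Averaging, Prop. 2 (54) p.26] -/
theorem cfgDistΦ_chiV4_naturalSel_of_le_gammaθ (p : ∀ K, AlphaInputsT3AC.PkgAtV4Chi F 𝔠 γ hγ hγ1 K) {a₀ a₁ p₁ : ℝ} (ha₀ : 0 < a₀) (ha₁ : 0 < a₁)
    (hp : ∀ K, (p K).a₀ = a₀ ∧ (p K).a₁ = a₁) (hp₁ : 𝔠.p₀ + 𝔠.r₀ ≤ p₁)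
    (hγw : γ ≤ gammaθ 𝔠.b₀ p₁ (min a₁ (min (a₀ / 𝔠.B₃) (min (1 / (3 * (143 * ((((3 + 4 : ℕ) : ℝ)) ^ 2 / 4) ^ 2) * 𝔠.B₃))
      (deltaSU (Fin 2) / ((((3 + 4) * F.L : ℕ) : ℝ) ^ 2 * 𝔠.B₃)))))) :
    CfgDistΦ (AlphaInputsT3AC.dataOfV4chi p (canonPolymerRows fun K => (p K).toRows))
      (fun K k b Y W c =>
        if h : b + 1 = k then birthCfgAtRows (fun K => (p K).toRows) K b Y (h ▸ W) c
        else if (l1 (rel (sel K b Y) c.src) : ℝ) *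
            (2 * (𝔠.B₃ * θBal F.L γ 𝔠.b₀ p₁ (K - k)) * (((F.L : ℝ) ^ (k - b))⁻¹) ^ 2) ≤ 1 / 2 then
          (lieC (suGroupModel 2)).orthogonalProjectionOnto
            (vecE (suGroupModel 2).N
              (B27T (unitsField (toUField (Averaging.iter (fun i => BlockAveraging.blockAvg (P := F.P K) (j := i) ℰp) b
                ((p K).UkH k (Hist.triv (F.P K) k) W)))) (sel K b Y) c))
        else 0)
      (canonLegDist F) 𝔠.b₀ p₁ (max (24 * F.L * 𝔠.B₃) (𝔠.cB * ((Real.sqrt F.L)⁻¹ * (1 + Real.log (Real.sqrt F.L)) ^ p₁))) := by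
  have hp₁' : 0 < p₁ := by have := 𝔠.p₀_pos; have := 𝔠.one_le_r₀; linarith
  refine cfgDistΦ_chiV4_naturalSel sel hsel p hp₁ fun K n _ => ?_
  obtain ⟨h1, h2, h3, h4⟩ := windowLetters_of_le_gammaθ (𝔠 := 𝔠) hγ (hγ1.trans (sq_min_one_le _ 𝔠.gamma0_pos)) ha₀ ha₁ hp₁' hγw n
  rw [(hp K).1, (hp K).2]
  exact ⟨h1, h2, h3, h4⟩

end ChiV4

end Summit.QuantumFields.YangMills.Theorems.GlobalSlackKernelLeg

end
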